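import Literature.MathematicalPhysics.KineticTheory.CollisionTubePullbackFlight
import Literature.MathematicalPhysics.KineticTheory.CollisionFluxUpperBound
import HarnessLib

/-!
# Short flights before a collision: charging to the previous collision (pathwise)

Topic `Literature/MathematicalPhysics/KineticTheory` (wanted by the crux line `even-rung-mean-variance` of
`JParityClosure.EvenStressEnskog`, stmt-AtomisticToContinuum-13079, residual `(S2b₂)` of the
collision-cylinder pull-back, `CollisionTubePullbackDefs.shortFlightDeficit`).

Along a good hard-sphere orbit on `𝕋³` the SHORT-FLIGHT DEFICIT of the pull-back,
`R_short = Σ_{collisions (s,i,j), s ∈ [0,τ]} |Ψ_c| · (pairFlightStart − (s − ℓ))₊` (`ℓ = κ ε` the length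
of the tube window), is charged to three collision sums whose marks are functions of the configuration
AT a collision (so that the window bound `measure_collisionSum_ge_le_liminf` of
`CollisionFluxUpperBound` applies to each):

`R_short ≤ C ℓ · (K₁ + K₃ + 2 K_F)` (`shortFlightDeficit_le_chargedSums`, `|Ψ| ≤ C`), where

* `K₁` = number of (ordered) collisions with time in `[0, ℓ]` (early collisions);
* `K₃ = Σ_{collisions} ‖vⱼ − vᵢ‖ / R`, `R = (1/2 − ε)/ℓ` — it dominates the number of collisions `(s, i, j)`
  whose pair ALSO collided at the pair flight start `s'' ∈ (s − ℓ, s)`: two collisions of the same pair in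
  free flight on the torus within time `< ℓ` force the pair to wrap around the torus, i.e. a relative
  speed `≥ R` (`one_le_relSpeed_div_of_recollision`; the outgoing pair separates, `sepAt_orbit_eq`);
* `K_F = Σ_{collisions (s'',p,m)} F(γ(s''), p, m)` with the FORWARD-CONTACT COUNT
  `F(w, p, m) = #{j' ∉ {p, m} : ‖reprSym((x_{j'} − x_p) + proj(t (v_{j'} − v_p)))‖ = ε for some t ∈ (0, ℓ)}`
  — every other collision `(s, i, j)` with a short flight is CHARGED to the last collision `(s'', p, m)`,
  `s'' ∈ (s − ℓ, s)`, of the partner `p ∈ {i, j}` that collided last: between `s''` and `s` both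
  partners fly freely (`flightStart`), so at the post-collisional configuration `γ(s'')` the other
  partner `j'` is on a free collision course with `p` with contact at time `s − s'' ∈ (0, ℓ)`
  (`charge_spec`, `orbit_posDiff_eq`); at most two ordered collisions are charged to the same
  `(s'', p, m)` (the next collision of `p`, in its two orders), whence the factor `2`.

This is the deterministic half of the estimate of `R_short` (Cercignani–Illner–Pulvirenti 1994 §2.2 and
App. 4.A: collisions preceded by another collision of a partner within a short time are controlled by
three-body contact configurations; Gallagher–Saint-Raymond–Texier 2013 §4.1).

## References

* C. Cercignani, R. Illner, M. Pulvirenti, *The Mathematical Theory of Dilute Gases* (1994), §2.2,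
  App. 4.A.  [CIPDiluteGases1994]
* I. Gallagher, L. Saint-Raymond, B. Texier, *From Newton to Boltzmann* (2013), Part II Ch. 4, §4.1,
  Prop. 4.1.1, Def. 4.1.2.  [GallagherSaintRaymondTexier2013]
-/

noncomputable section

open scoped BigOperators Classical InnerProductSpace ENNReal Topology
open Set MeasureTheory Filter Function
open Literature.Analysis.FluidPDE Literature.Analysis.FunctionSpaces

namespace Literature.MathematicalPhysics.KineticTheory

variable {σ : ℝ} {N : ℕ} {Φ : HardSphereFlow (Torus.geometry (Fin 3)) (hsDiameter σ N) (N + 1)}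
  {z : Config (N + 1) (Fin 3) T3}

/-! ## Flight starts along a good orbit -/

/-- Along a good orbit the flight start of a particle at a time `s ≥ 0` lies in `[0, s]`. [folklore] -/
theorem flightStart_mem_Icc (hz : z ∈ Φ.good) (k : Fin (N + 1)) {s : ℝ} (hs : 0 ≤ s) :
    flightStart (Torus.geometry (Fin 3)) (hsDiameter σ N) (orbit σ N Φ z) 0 k s ∈ Icc 0 s := by
  rcases mem_insert_iff.1 ((isTraj hz).flightStart_mem 0 k s) with h | h
  · rw [h]; exact ⟨le_rfl, hs⟩
  · exact ⟨h.2.1.le, h.2.2.le⟩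

/-- Along a good orbit the pair flight start at a time `s ≥ 0` lies in `[0, s]`. [folklore] -/
theorem pairFlightStart_mem_Icc (hz : z ∈ Φ.good) (i j : Fin (N + 1)) {s : ℝ} (hs : 0 ≤ s) :
    pairFlightStart σ N Φ z i j s ∈ Icc 0 s := by
  have hi := flightStart_mem_Icc hz i hs
  have hj := flightStart_mem_Icc hz j hs
  exact ⟨le_max_of_le_left hi.1, max_le hi.2 hj.2⟩

/-- The short-flight deficit of one collision is at most the window length `ℓ ≥ 0`. [folklore] -/
theorem deficit_le (hz : z ∈ Φ.good) (i j : Fin (N + 1)) {s ℓ : ℝ} (hs : 0 ≤ s) (hℓ : 0 ≤ ℓ) :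
    max (pairFlightStart σ N Φ z i j s - (s - ℓ)) 0 ≤ ℓ :=
  max_le (by linarith [(pairFlightStart_mem_Icc hz i j hs).2]) hℓ

/-- A positive flight start is a collision time of the particle in `(0, s)`. [folklore] -/
theorem flightStart_spec (hz : z ∈ Φ.good) (k : Fin (N + 1)) {s : ℝ}
    (hpos : 0 < flightStart (Torus.geometry (Fin 3)) (hsDiameter σ N) (orbit σ N Φ z) 0 k s) :
    flightStart (Torus.geometry (Fin 3)) (hsDiameter σ N) (orbit σ N Φ z) 0 k s ∈ Ioo 0 s ∧
      Participates (Torus.geometry (Fin 3)) (hsDiameter σ N)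
        (orbit σ N Φ z (flightStart (Torus.geometry (Fin 3)) (hsDiameter σ N) (orbit σ N Φ z) 0 k s)) k := by
  rcases mem_insert_iff.1 ((isTraj hz).flightStart_mem 0 k s) with h | h
  · rw [h] at hpos; exact absurd hpos (lt_irrefl 0)
  · exact ⟨h.2, h.1⟩

/-- **The next collision of a freely flying particle is unique**: if `p` takes part in no collision during
`(s'', s₁)` and `(s'', s₂)` but does at `s₁` and at `s₂`, then `s₁ = s₂`. [folklore] -/
theorem eq_of_nextCollision {γ : ℝ → Config (N + 1) (Fin 3) T3} {ε : ℝ} {p : Fin (N + 1)} {s'' s₁ s₂ : ℝ}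
    (h₁ : s'' < s₁) (h₂ : s'' < s₂)
    (hf₁ : ∀ u ∈ Ioo s'' s₁, ¬ Participates (Torus.geometry (Fin 3)) ε (γ u) p)
    (hp₁ : Participates (Torus.geometry (Fin 3)) ε (γ s₁) p)
    (hf₂ : ∀ u ∈ Ioo s'' s₂, ¬ Participates (Torus.geometry (Fin 3)) ε (γ u) p)
    (hp₂ : Participates (Torus.geometry (Fin 3)) ε (γ s₂) p) : s₁ = s₂ := by
  by_contra hne
  rcases lt_or_gt_of_ne hne with hlt | hgt
  · exact hf₂ s₁ ⟨h₁, hlt⟩ hp₁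
  · exact hf₁ s₂ ⟨h₂, hgt⟩ hp₂

/-! ## Charging a short flight to the previous collision -/

/-- **Charging.** Let `(p, o)` collide at time `s` along a good orbit, let `p` have collided at
`s'' ∈ (s − ℓ, s)` (with partner `m = partner p`) and let `p` and `o` fly freely on `(s'', s)`, `o` not
taking part in the collision at `s''`.  Then `(p, m)` is a contact pair at `s''`, `o ∉ {p, m}`, and at the
post-collisional configuration `γ(s'')` the pair `(o, p)` is on a free collision course with contact at the
forward time `s − s'' ∈ (0, ℓ)`: `‖reprSym((x_o − x_p) + proj((s − s'')(v_o − v_p)))‖ = ε`. [folklore] -/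
theorem charge_spec (hz : z ∈ Φ.good) (hε2 : hsDiameter σ N < 1 / 2) {p o : Fin (N + 1)} {s s'' ℓ : ℝ}
    (hs'' : s'' < s) (hℓ : s - ℓ < s'')
    (hp : Participates (Torus.geometry (Fin 3)) (hsDiameter σ N) (orbit σ N Φ z s'') p)
    (hpf : ∀ u ∈ Ioo s'' s, ¬ Participates (Torus.geometry (Fin 3)) (hsDiameter σ N) (orbit σ N Φ z u) p)
    (hof : ∀ u ∈ Ioo s'' s, ¬ Participates (Torus.geometry (Fin 3)) (hsDiameter σ N) (orbit σ N Φ z u) o)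
    (ho : ¬ Participates (Torus.geometry (Fin 3)) (hsDiameter σ N) (orbit σ N Φ z s'') o)
    (hc : (p, o) ∈ contactPairs (Torus.geometry (Fin 3)) (hsDiameter σ N) (orbit σ N Φ z s)) :
    (p, partner (Torus.geometry (Fin 3)) (hsDiameter σ N) (orbit σ N Φ z s'') p) ∈
        contactPairs (Torus.geometry (Fin 3)) (hsDiameter σ N) (orbit σ N Φ z s'') ∧
      o ≠ p ∧ o ≠ partner (Torus.geometry (Fin 3)) (hsDiameter σ N) (orbit σ N Φ z s'') p ∧
      ∃ t ∈ Ioo 0 ℓ, ‖Torus.reprSym (((orbit σ N Φ z s'' o).1 - (orbit σ N Φ z s'' p).1) +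
        Torus.proj (t • ((orbit σ N Φ z s'' o).2 - (orbit σ N Φ z s'' p).2)))‖ = hsDiameter σ N := by
  have hG : (Torus.geometry (Fin 3)).IsHardSphereRegular (hsDiameter σ N) :=
    Torus.isHardSphereRegular_geometry (by rw [← one_div]; exact hε2)
  have hpm : (p, partner (Torus.geometry (Fin 3)) (hsDiameter σ N) (orbit σ N Φ z s'') p) ∈
      contactPairs (Torus.geometry (Fin 3)) (hsDiameter σ N) (orbit σ N Φ z s'') := by
    rcases collide_partner hp with h | h
    · exact h
    · exact (swap_mem_contactPairs_iff hG).1 h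
  have hmpart : Participates (Torus.geometry (Fin 3)) (hsDiameter σ N) (orbit σ N Φ z s'')
      (partner (Torus.geometry (Fin 3)) (hsDiameter σ N) (orbit σ N Φ z s'') p) :=
    ⟨p, (collide_partner hp).symm⟩
  have hop : o ≠ p := fun h => ho (h ▸ hp)
  have hom : o ≠ partner (Torus.geometry (Fin 3)) (hsDiameter σ N) (orbit σ N Φ z s'') p :=
    fun h => ho (h ▸ hmpart)
  refine ⟨hpm, hop, hom, s - s'', ⟨sub_pos.2 hs'', by linarith⟩, ?_⟩
  -- contact of `(o, p)` at time `s`, positions by the pair free flight from `s''`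
  have hco : (o, p) ∈ contactPairs (Torus.geometry (Fin 3)) (hsDiameter σ N) (orbit σ N Φ z s) :=
    (swap_mem_contactPairs_iff hG).1 hc
  have hnorm := ((mem_contactPairs_iff_of_mem (orbit_mem hz s)).1 hco).2
  rw [Torus.geometry_sepVec, orbit_posDiff_eq hz hs''.le hof hpf ⟨hs''.le, le_rfl⟩] at hnorm
  exact hnorm

/-- **Two collisions of the same pair within a free flight of duration `< ℓ` need relative speed
`≥ (1/2 − ε)/ℓ`.**  If `i` and `j` collide at `s''` and again at `s ∈ (s'', s'' + ℓ)`, both flying freely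
in between, then `1 ≤ ‖vⱼ(s) − vᵢ(s)‖ / ((1/2 − ε)/ℓ)`: the outgoing pair separates
(`‖q₀ + t w‖² = ε² + 2t⟪q₀, w⟫ + t²‖w‖² > ε²`) as long as the minimal image follows the free flight
(`‖q₀ + t w‖ < 1/2`, `sepAt_orbit_eq`), so re-contact forces `‖q₀ + (s − s'') w‖ ≥ 1/2`; and the modulus
of the relative velocity is the same before and after the collision at `s`. [folklore] -/
theorem one_le_relSpeed_div_of_recollision (hz : z ∈ Φ.good) (hε2 : hsDiameter σ N < 1 / 2)
    {i j : Fin (N + 1)} {s s'' ℓ : ℝ} (hs'' : s'' < s) (hℓs : s - ℓ < s'') (hℓ : 0 < ℓ)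
    (hi : Participates (Torus.geometry (Fin 3)) (hsDiameter σ N) (orbit σ N Φ z s'') i)
    (hj : Participates (Torus.geometry (Fin 3)) (hsDiameter σ N) (orbit σ N Φ z s'') j)
    (hif : ∀ u ∈ Ioo s'' s, ¬ Participates (Torus.geometry (Fin 3)) (hsDiameter σ N) (orbit σ N Φ z u) i)
    (hjf : ∀ u ∈ Ioo s'' s, ¬ Participates (Torus.geometry (Fin 3)) (hsDiameter σ N) (orbit σ N Φ z u) j)
    (hc : (i, j) ∈ contactPairs (Torus.geometry (Fin 3)) (hsDiameter σ N) (orbit σ N Φ z s)) :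
    1 ≤ ‖(orbit σ N Φ z s j).2 - (orbit σ N Φ z s i).2‖ / ((1 / 2 - hsDiameter σ N) / ℓ) := by
  have hγ := isTraj hz
  have hG : (Torus.geometry (Fin 3)).IsHardSphereRegular (hsDiameter σ N) :=
    Torus.isHardSphereRegular_geometry (by rw [← one_div]; exact hε2)
  have hij : i ≠ j := (mem_contactPairs.1 hc).1
  -- `(i, j)` is the contact pair at `s''`
  have hc'' : (i, j) ∈ contactPairs (Torus.geometry (Fin 3)) (hsDiameter σ N) (orbit σ N Φ z s'') := by
    have him : (i, partner (Torus.geometry (Fin 3)) (hsDiameter σ N) (orbit σ N Φ z s'') i) ∈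
        contactPairs (Torus.geometry (Fin 3)) (hsDiameter σ N) (orbit σ N Φ z s'') := by
      rcases collide_partner hi with h | h
      · exact h
      · exact (swap_mem_contactPairs_iff hG).1 h
    rcases (hγ.participates_iff him).1 hj with h | h
    · exact absurd h.symm hij
    · rw [← h] at him; exact him
  have hq0 : ‖sepAt (orbit σ N Φ z s'') i j‖ = hsDiameter σ N :=
    ((mem_contactPairs_iff_of_mem (orbit_mem hz s'')).1 hc'').2
  have hqs : ‖sepAt (orbit σ N Φ z s) i j‖ = hsDiameter σ N :=
    ((mem_contactPairs_iff_of_mem (orbit_mem hz s)).1 hc).2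
  -- outgoing at `s''`
  have hout : 0 < ⟪sepAt (orbit σ N Φ z s'') i j, relVel (orbit σ N Φ z s'') i j⟫_ℝ :=
    hγ.inner_sepVec_postVel_pos hc''
  -- no short re-contact
  have hbig : 1 / 2 ≤ ‖sepAt (orbit σ N Φ z s'') i j + (s - s'') • relVel (orbit σ N Φ z s'') i j‖ := by
    by_contra hlt
    have heq := sepAt_orbit_eq hz hs''.le hif hjf ⟨le_rfl, hs''.le⟩ ⟨hs''.le, le_rfl⟩ (not_le.1 hlt)
    have hexp : ‖sepAt (orbit σ N Φ z s'') i j + (s - s'') • relVel (orbit σ N Φ z s'') i j‖ ^ 2 =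
        ‖sepAt (orbit σ N Φ z s'') i j‖ ^ 2 +
          2 * (s - s'') * ⟪sepAt (orbit σ N Φ z s'') i j, relVel (orbit σ N Φ z s'') i j⟫_ℝ +
          (s - s'') ^ 2 * ‖relVel (orbit σ N Φ z s'') i j‖ ^ 2 := by
      rw [norm_add_sq_real, inner_smul_right, norm_smul, mul_pow, Real.norm_eq_abs, sq_abs]; ring
    have hlt2 : hsDiameter σ N ^ 2 < ‖sepAt (orbit σ N Φ z s) i j‖ ^ 2 := by
      rw [heq, hexp, hq0]
      nlinarith [mul_pos (sub_pos.2 hs'') hout, sq_nonneg ((s - s'') * ‖relVel (orbit σ N Φ z s'') i j‖)]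
    rw [hqs] at hlt2
    exact lt_irrefl _ hlt2
  have h1 : 1 / 2 - hsDiameter σ N ≤ (s - s'') * ‖relVel (orbit σ N Φ z s'') i j‖ := by
    have h := norm_add_le (sepAt (orbit σ N Φ z s'') i j) ((s - s'') • relVel (orbit σ N Φ z s'') i j)
    rw [norm_smul, Real.norm_eq_abs, abs_of_pos (sub_pos.2 hs''), hq0] at h
    linarith
  have h2 : 1 / 2 - hsDiameter σ N ≤ ℓ * ‖relVel (orbit σ N Φ z s'') i j‖ :=
    h1.trans (mul_le_mul_of_nonneg_right (by linarith) (norm_nonneg _))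
  -- the modulus of the relative velocity at `s''` is that after the collision at `s`
  have hw : ‖relVel (orbit σ N Φ z s'') i j‖ = ‖(orbit σ N Φ z s j).2 - (orbit σ N Φ z s i).2‖ := by
    have hr := reflectVel_orbit_eq hz hs'' hif hjf hc
    have hn := norm_snd_sub_fst_reflectVel (sepAt (orbit σ N Φ z s) i j)
      ((orbit σ N Φ z s i).2, (orbit σ N Φ z s j).2)
    rw [hr] at hn
    rw [← hn, norm_sub_rev]
    rfl
  rw [le_div_iff₀ (div_pos (by linarith) hℓ), one_mul, div_le_iff₀ hℓ, ← hw, mul_comm]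
  exact h2

/-! ## The short-flight count and the short-flight deficit against the charged sums -/

/-- **Short flights are charged to early collisions, fast re-collisions and forward contact partners
(pathwise).**  Along a good orbit, for `τ` and a window length `ℓ > 0`, the number of ordered collisions
`(s, i, j)`, `s ∈ [0, τ]`, whose pair flight start exceeds `s − ℓ` (a partner collided during
`(s − ℓ, s)`, or `s < ℓ`) is at most `K₁ + K₃ + 2 K_F`: `K₁` the number of ordered collisions with time
in `[0, ℓ]`, `K₃ = Σ_{collisions} ‖vⱼ − vᵢ‖ / ((1/2 − ε)/ℓ)`, and `K_F` the collision sum of the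
forward-contact count `#{j' ∉ {i, j} : ‖reprSym((x_{j'} − xᵢ) + proj(t (v_{j'} − vᵢ)))‖ = ε, t ∈ (0, ℓ)}`
read at the collision. [folklore] -/
theorem shortFlightCount_le_chargedSums (hz : z ∈ Φ.good) (hε2 : hsDiameter σ N < 1 / 2) (τ : ℝ)
    {ℓ : ℝ} (hℓ : 0 < ℓ) :
    collisionPairSum (Torus.geometry (Fin 3)) (hsDiameter σ N) (orbit σ N Φ z) (Icc 0 τ)
        (fun s i j => if s - ℓ < pairFlightStart σ N Φ z i j s then (1 : ℝ) else 0) ≤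
      collisionPairSum (Torus.geometry (Fin 3)) (hsDiameter σ N) (orbit σ N Φ z) (Icc 0 ℓ)
          (fun _ _ _ => (1 : ℝ)) +
        collisionPairSum (Torus.geometry (Fin 3)) (hsDiameter σ N) (orbit σ N Φ z) (Icc 0 τ)
          (fun s i j => ‖(orbit σ N Φ z s j).2 - (orbit σ N Φ z s i).2‖ / ((1 / 2 - hsDiameter σ N) / ℓ)) +
        2 * collisionPairSum (Torus.geometry (Fin 3)) (hsDiameter σ N) (orbit σ N Φ z) (Icc 0 τ)
          (fun s i j => ∑ j' : Fin (N + 1), if j' ≠ i ∧ j' ≠ j ∧ ∃ t ∈ Ioo 0 ℓ,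
            ‖Torus.reprSym (((orbit σ N Φ z s j').1 - (orbit σ N Φ z s i).1) +
              Torus.proj (t • ((orbit σ N Φ z s j').2 - (orbit σ N Φ z s i).2)))‖ = hsDiameter σ N
            then (1 : ℝ) else 0) := by
  classical
  have hγ := isTraj hz
  have hG : (Torus.geometry (Fin 3)).IsHardSphereRegular (hsDiameter σ N) :=
    Torus.isHardSphereRegular_geometry (by rw [← one_div]; exact hε2)
  have hfinτ := hγ.locFinite 0 τ
  have hfinℓ := hγ.locFinite 0 ℓ
  have hTf := finite_collisionTriples hfinτ
  have hTℓf := finite_collisionTriples hfinℓ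
  rw [collisionPairSum_eq_finsum_triples hfinτ, collisionPairSum_eq_finsum_triples hfinℓ,
    collisionPairSum_eq_finsum_triples hfinτ, collisionPairSum_eq_finsum_triples hfinτ,
    finsum_mem_eq_finite_toFinset_sum _ hTf, finsum_mem_eq_finite_toFinset_sum _ hTℓf,
    finsum_mem_eq_finite_toFinset_sum _ hTf, finsum_mem_eq_finite_toFinset_sum _ hTf]
  -- notation
  set T := hTf.toFinset with hTdef
  set Tℓ := hTℓf.toFinset with hTℓdef
  set fs : Fin (N + 1) → ℝ → ℝ := fun k s =>
    flightStart (Torus.geometry (Fin 3)) (hsDiameter σ N) (orbit σ N Φ z) 0 k s with hfsdef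
  set st : ℝ × Fin (N + 1) × Fin (N + 1) → ℝ := fun e => pairFlightStart σ N Φ z e.2.1 e.2.2 e.1
    with hstdef
  set ld : ℝ × Fin (N + 1) × Fin (N + 1) → Fin (N + 1) := fun e =>
    if fs e.2.2 e.1 ≤ fs e.2.1 e.1 then e.2.1 else e.2.2 with hlddef
  set ot : ℝ × Fin (N + 1) × Fin (N + 1) → Fin (N + 1) := fun e =>
    if fs e.2.2 e.1 ≤ fs e.2.1 e.1 then e.2.2 else e.2.1 with hotdef
  set F : ℝ × Fin (N + 1) × Fin (N + 1) → ℝ := fun e => ∑ j' : Fin (N + 1),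
    if j' ≠ e.2.1 ∧ j' ≠ e.2.2 ∧ ∃ t ∈ Ioo 0 ℓ,
      ‖Torus.reprSym (((orbit σ N Φ z e.1 j').1 - (orbit σ N Φ z e.1 e.2.1).1) +
        Torus.proj (t • ((orbit σ N Φ z e.1 j').2 - (orbit σ N Φ z e.1 e.2.1).2)))‖ = hsDiameter σ N
      then (1 : ℝ) else 0 with hFdef
  set b : ℝ × Fin (N + 1) × Fin (N + 1) → ℝ := fun e =>
    ‖(orbit σ N Φ z e.1 e.2.2).2 - (orbit σ N Φ z e.1 e.2.1).2‖ / ((1 / 2 - hsDiameter σ N) / ℓ) with hbdef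
  set Θ : ℝ × Fin (N + 1) × Fin (N + 1) → ℝ × Fin (N + 1) × Fin (N + 1) := fun e =>
    (st e, ld e, partner (Torus.geometry (Fin 3)) (hsDiameter σ N) (orbit σ N Φ z (st e)) (ld e)) with hΘdef
  set B₁ : Finset (ℝ × Fin (N + 1) × Fin (N + 1)) := T.filter fun e => 0 < st e ∧ e.1 - ℓ < st e ∧
    ¬ Participates (Torus.geometry (Fin 3)) (hsDiameter σ N) (orbit σ N Φ z (st e)) (ot e) with hB₁def
  set B₂ : Finset (ℝ × Fin (N + 1) × Fin (N + 1)) := T.filter fun e => 0 < st e ∧ e.1 - ℓ < st e ∧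
    Participates (Torus.geometry (Fin 3)) (hsDiameter σ N) (orbit σ N Φ z (st e)) (ot e) with hB₂def
  change ∑ e ∈ T, (if e.1 - ℓ < st e then (1 : ℝ) else 0) ≤
    ∑ e ∈ Tℓ, (1 : ℝ) + ∑ e ∈ T, b e + 2 * ∑ e ∈ T, F e
  -- membership
  have hT : ∀ e ∈ T, e.1 ∈ Icc 0 τ ∧
      e.2 ∈ contactPairs (Torus.geometry (Fin 3)) (hsDiameter σ N) (orbit σ N Φ z e.1) := fun e he =>
    mem_collisionTriples.1 (hTf.mem_toFinset.1 he)
  -- the lead particle realises the pair flight start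
  have hld : ∀ e, st e = fs (ld e) e.1 ∧ fs (ot e) e.1 ≤ st e ∧
      ((ld e = e.2.1 ∧ ot e = e.2.2) ∨ (ld e = e.2.2 ∧ ot e = e.2.1)) := by
    intro e
    by_cases h : fs e.2.2 e.1 ≤ fs e.2.1 e.1
    · have hl : ld e = e.2.1 := by rw [hlddef]; exact if_pos h
      have ho : ot e = e.2.2 := by rw [hotdef]; exact if_pos h
      refine ⟨?_, ?_, Or.inl ⟨hl, ho⟩⟩
      · rw [hl]; exact max_eq_left h
      · rw [ho]; exact le_max_right _ _
    · have hl : ld e = e.2.2 := by rw [hlddef]; exact if_neg h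
      have ho : ot e = e.2.1 := by rw [hotdef]; exact if_neg h
      refine ⟨?_, ?_, Or.inr ⟨hl, ho⟩⟩
      · rw [hl]; exact max_eq_right (not_le.1 h).le
      · rw [ho]; exact le_max_left _ _
  -- consequences of a positive short pair flight start
  have hβ : ∀ e ∈ T, 0 < st e → st e ∈ Ioo 0 e.1 ∧
      Participates (Torus.geometry (Fin 3)) (hsDiameter σ N) (orbit σ N Φ z (st e)) (ld e) ∧
      (∀ u ∈ Ioo (st e) e.1, ¬ Participates (Torus.geometry (Fin 3)) (hsDiameter σ N) (orbit σ N Φ z u) (ld e)) ∧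
      (∀ u ∈ Ioo (st e) e.1, ¬ Participates (Torus.geometry (Fin 3)) (hsDiameter σ N) (orbit σ N Φ z u) (ot e)) ∧
      (ld e, ot e) ∈ contactPairs (Torus.geometry (Fin 3)) (hsDiameter σ N) (orbit σ N Φ z e.1) := by
    intro e he hpos
    obtain ⟨hst, hot, hor⟩ := hld e
    rw [hst] at hpos ⊢
    obtain ⟨hIoo, hpart⟩ := flightStart_spec hz (ld e) hpos
    refine ⟨hIoo, hpart, fun u hu => hγ.not_participates_of_mem_Ioo_flightStart hu, fun u hu =>
      hγ.not_participates_of_mem_Ioo_flightStart ⟨(hst ▸ hot).trans_lt hu.1, hu.2⟩, ?_⟩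
    rcases hor with ⟨h1, h2⟩ | ⟨h1, h2⟩
    · rw [h1, h2]; exact (hT e he).2
    · rw [h1, h2]; exact (swap_mem_contactPairs_iff hG).1 (hT e he).2
  -- (1) pointwise: a short flight is early, or charged
  have hpt : ∀ e ∈ T, (if e.1 - ℓ < st e then (1 : ℝ) else 0) ≤
      (if e.1 ≤ ℓ then (1 : ℝ) else 0) + (if e ∈ B₂ then (1 : ℝ) else 0) + (if e ∈ B₁ then (1 : ℝ) else 0) := by
    intro e he
    by_cases hsh : e.1 - ℓ < st e
    · rw [if_pos hsh]
      by_cases hpos : 0 < st e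
      · by_cases hpart : Participates (Torus.geometry (Fin 3)) (hsDiameter σ N) (orbit σ N Φ z (st e)) (ot e)
        · have : e ∈ B₂ := Finset.mem_filter.2 ⟨he, hpos, hsh, hpart⟩
          rw [if_pos this]; split_ifs <;> norm_num
        · have : e ∈ B₁ := Finset.mem_filter.2 ⟨he, hpos, hsh, hpart⟩
          rw [if_pos this]; split_ifs <;> norm_num
      · have h0 : 0 ≤ st e := (pairFlightStart_mem_Icc hz e.2.1 e.2.2 (hT e he).1.1).1
        have : e.1 ≤ ℓ := by linarith [not_lt.1 hpos]
        rw [if_pos this]; split_ifs <;> norm_num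
    · rw [if_neg hsh]; split_ifs <;> norm_num
  -- (2) early collisions
  have h1 : ∑ e ∈ T, (if e.1 ≤ ℓ then (1 : ℝ) else 0) ≤ ∑ e ∈ Tℓ, (1 : ℝ) := by
    rw [← Finset.sum_filter]
    refine Finset.sum_le_sum_of_subset_of_nonneg (fun e he => ?_) fun _ _ _ => zero_le_one
    rw [Finset.mem_filter] at he
    exact hTℓf.mem_toFinset.2 ⟨⟨(hT e he.1).1.1, he.2⟩, (hT e he.1).2⟩
  -- (3) fast re-collisions
  have h2 : ∑ e ∈ T, (if e ∈ B₂ then (1 : ℝ) else 0) ≤ ∑ e ∈ T, b e := by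
    refine Finset.sum_le_sum fun e he => ?_
    by_cases hB : e ∈ B₂
    · rw [if_pos hB]
      obtain ⟨-, hpos, hsh, hpart⟩ := Finset.mem_filter.1 hB
      obtain ⟨hIoo, hpl, hfl, hfo, hc⟩ := hβ e he hpos
      have h := one_le_relSpeed_div_of_recollision hz hε2 hIoo.2 hsh hℓ hpl hpart hfl hfo hc
      rcases (hld e).2.2 with ⟨hl, ho⟩ | ⟨hl, ho⟩
      · rw [hl, ho] at h
        exact h
      · rw [hl, ho, norm_sub_rev] at h
        exact h
    · rw [if_neg hB]
      exact div_nonneg (norm_nonneg _) (div_nonneg (by linarith) hℓ.le)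
  -- (4) the charging map on `B₁`
  have hch : ∀ e ∈ B₁, Θ e ∈ T ∧ 1 ≤ F (Θ e) ∧
      (∀ u ∈ Ioo (st e) e.1, ¬ Participates (Torus.geometry (Fin 3)) (hsDiameter σ N) (orbit σ N Φ z u) (ld e)) ∧
      Participates (Torus.geometry (Fin 3)) (hsDiameter σ N) (orbit σ N Φ z e.1) (ld e) ∧ st e < e.1 ∧
      (ld e, ot e) ∈ contactPairs (Torus.geometry (Fin 3)) (hsDiameter σ N) (orbit σ N Φ z e.1) := by
    intro e hB
    obtain ⟨he, hpos, hsh, hpart⟩ := Finset.mem_filter.1 hB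
    obtain ⟨hIoo, hpl, hfl, hfo, hc⟩ := hβ e he hpos
    obtain ⟨hpm, hop, hom, t, ht, hhit⟩ := charge_spec hz hε2 hIoo.2 hsh hpl hfl hfo hpart hc
    refine ⟨hTf.mem_toFinset.2 ⟨⟨hIoo.1.le, hIoo.2.le.trans (hT e he).1.2⟩, hpm⟩, ?_, hfl, ⟨ot e, Or.inl hc⟩,
      hIoo.2, hc⟩
    have hterm : (1 : ℝ) ≤ (if ot e ≠ ld e ∧
        ot e ≠ partner (Torus.geometry (Fin 3)) (hsDiameter σ N) (orbit σ N Φ z (st e)) (ld e) ∧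
        ∃ t ∈ Ioo 0 ℓ, ‖Torus.reprSym (((orbit σ N Φ z (st e) (ot e)).1 - (orbit σ N Φ z (st e) (ld e)).1) +
          Torus.proj (t • ((orbit σ N Φ z (st e) (ot e)).2 - (orbit σ N Φ z (st e) (ld e)).2)))‖ =
            hsDiameter σ N then (1 : ℝ) else 0) := by
      rw [if_pos ⟨hop, hom, t, ht, hhit⟩]
    refine hterm.trans ?_
    exact Finset.single_le_sum (f := fun j' => if j' ≠ ld e ∧
        j' ≠ partner (Torus.geometry (Fin 3)) (hsDiameter σ N) (orbit σ N Φ z (st e)) (ld e) ∧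
        ∃ t ∈ Ioo 0 ℓ, ‖Torus.reprSym (((orbit σ N Φ z (st e) j').1 - (orbit σ N Φ z (st e) (ld e)).1) +
          Torus.proj (t • ((orbit σ N Φ z (st e) j').2 - (orbit σ N Φ z (st e) (ld e)).2)))‖ =
            hsDiameter σ N then (1 : ℝ) else 0)
      (fun j' _ => by positivity) (Finset.mem_univ (ot e))
  -- at most two short-flight collisions are charged to the same collision
  have hfib : ∀ y ∈ B₁.image Θ, (B₁.filter fun e => Θ e = y).card ≤ 2 := by
    intro y hy
    obtain ⟨e₀, he₀, rfl⟩ := Finset.mem_image.1 hy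
    obtain ⟨-, -, hf₀, hp₀, hlt₀, hc₀⟩ := hch e₀ he₀
    have hsub : (B₁.filter fun e => Θ e = Θ e₀) ⊆ {(e₀.1, (ld e₀, ot e₀)), (e₀.1, (ot e₀, ld e₀))} := by
      intro e he
      obtain ⟨heB, heq⟩ := Finset.mem_filter.1 he
      obtain ⟨-, -, hf, hp, hlt, hc⟩ := hch e heB
      have hst : st e = st e₀ := congrArg Prod.fst heq
      have hlde : ld e = ld e₀ := congrArg (fun q => q.2.1) heq
      rw [hst, hlde] at hf
      rw [hlde] at hp hc
      have hs : e.1 = e₀.1 := eq_of_nextCollision (hst ▸ hlt) hlt₀ hf hp hf₀ hp₀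
      rw [hs] at hc
      have hpair := hγ.contactPairs_eq_pair hG hc₀
      have h2 : e.2 ∈ contactPairs (Torus.geometry (Fin 3)) (hsDiameter σ N) (orbit σ N Φ z e₀.1) := by
        rcases (hld e).2.2 with ⟨hl, ho⟩ | ⟨hl, ho⟩
        · have : e.2 = (ld e, ot e) := Prod.ext hl.symm ho.symm
          rw [this, hlde]; exact hc
        · have : e.2 = (ot e, ld e) := Prod.ext ho.symm hl.symm
          rw [this, hlde]; exact (swap_mem_contactPairs_iff hG).2 hc
      rw [hpair, Finset.mem_insert, Finset.mem_singleton] at h2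
      rw [Finset.mem_insert, Finset.mem_singleton]
      rcases h2 with h2 | h2
      · exact Or.inl (Prod.ext hs h2)
      · exact Or.inr (Prod.ext hs h2)
    exact (Finset.card_le_card hsub).trans Finset.card_le_two
  have h3 : ∑ e ∈ T, (if e ∈ B₁ then (1 : ℝ) else 0) ≤ 2 * ∑ e ∈ T, F e := by
    have hB₁T : B₁ ⊆ T := Finset.filter_subset _ _
    have hsum : ∑ e ∈ T, (if e ∈ B₁ then (1 : ℝ) else 0) = B₁.card := by
      rw [← Finset.sum_filter, Finset.filter_mem_eq_inter, Finset.inter_eq_right.2 hB₁T,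
        Finset.sum_const, nsmul_eq_mul, mul_one]
    have hcard : (B₁.card : ℝ) ≤ 2 * ((B₁.image Θ).card : ℝ) := by
      exact_mod_cast Finset.card_le_mul_card_image B₁ 2 hfib
    have himg : ((B₁.image Θ).card : ℝ) ≤ ∑ y ∈ B₁.image Θ, F y := by
      rw [← mul_one ((B₁.image Θ).card : ℝ), ← nsmul_eq_mul, ← Finset.sum_const]
      refine Finset.sum_le_sum fun y hy => ?_
      obtain ⟨e, he, rfl⟩ := Finset.mem_image.1 hy
      exact (hch e he).2.1
    have himgT : ∑ y ∈ B₁.image Θ, F y ≤ ∑ e ∈ T, F e :=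
      Finset.sum_le_sum_of_subset_of_nonneg (fun y hy => by
        obtain ⟨e, he, rfl⟩ := Finset.mem_image.1 hy
        exact (hch e he).1) fun e _ _ => Finset.sum_nonneg fun j' _ => by positivity
    rw [hsum]
    linarith
  -- assemble
  calc ∑ e ∈ T, (if e.1 - ℓ < st e then (1 : ℝ) else 0)
      ≤ ∑ e ∈ T, ((if e.1 ≤ ℓ then (1 : ℝ) else 0) + (if e ∈ B₂ then (1 : ℝ) else 0) +
          (if e ∈ B₁ then (1 : ℝ) else 0)) := Finset.sum_le_sum hpt
    _ = ∑ e ∈ T, (if e.1 ≤ ℓ then (1 : ℝ) else 0) + ∑ e ∈ T, (if e ∈ B₂ then (1 : ℝ) else 0) +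
          ∑ e ∈ T, (if e ∈ B₁ then (1 : ℝ) else 0) := by
        rw [Finset.sum_add_distrib, Finset.sum_add_distrib]
    _ ≤ ∑ e ∈ Tℓ, (1 : ℝ) + ∑ e ∈ T, b e + 2 * ∑ e ∈ T, F e := add_le_add (add_le_add h1 h2) h3

/-- **The short-flight deficit against the charged sums.**  Along a good orbit, for a bounded mark
`|Ψ| ≤ C` and a window `ℓ = κ ε > 0`,
`shortFlightDeficit ≤ C ℓ · (K₁ + K₃ + 2 K_F)` with the three collision sums of
`shortFlightCount_le_chargedSums` (the deficit of one collision is at most `ℓ`, and vanishes unless the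
pair flight start exceeds `s − ℓ`). [folklore] -/
theorem shortFlightDeficit_le_chargedSums (hz : z ∈ Φ.good) (hε2 : hsDiameter σ N < 1 / 2)
    {Ψ : V3 × V3 × V3 → ℝ} {C : ℝ} (hΨ : ∀ q, |Ψ q| ≤ C) (τ : ℝ) {κ : ℝ} (hℓ : 0 < κ * hsDiameter σ N) :
    shortFlightDeficit σ N Φ τ Ψ κ z ≤
      C * (κ * hsDiameter σ N) *
        (collisionPairSum (Torus.geometry (Fin 3)) (hsDiameter σ N) (orbit σ N Φ z)
            (Icc 0 (κ * hsDiameter σ N)) (fun _ _ _ => (1 : ℝ)) +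
          collisionPairSum (Torus.geometry (Fin 3)) (hsDiameter σ N) (orbit σ N Φ z) (Icc 0 τ)
            (fun s i j => ‖(orbit σ N Φ z s j).2 - (orbit σ N Φ z s i).2‖ /
              ((1 / 2 - hsDiameter σ N) / (κ * hsDiameter σ N))) +
          2 * collisionPairSum (Torus.geometry (Fin 3)) (hsDiameter σ N) (orbit σ N Φ z) (Icc 0 τ)
            (fun s i j => ∑ j' : Fin (N + 1), if j' ≠ i ∧ j' ≠ j ∧ ∃ t ∈ Ioo 0 (κ * hsDiameter σ N),
              ‖Torus.reprSym (((orbit σ N Φ z s j').1 - (orbit σ N Φ z s i).1) +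
                Torus.proj (t • ((orbit σ N Φ z s j').2 - (orbit σ N Φ z s i).2)))‖ = hsDiameter σ N
              then (1 : ℝ) else 0)) := by
  have hC : 0 ≤ C := (abs_nonneg _).trans (hΨ 0)
  have hfin := (isTraj hz).locFinite 0 τ
  refine le_trans ?_ (mul_le_mul_of_nonneg_left (shortFlightCount_le_chargedSums hz hε2 τ hℓ)
    (mul_nonneg hC hℓ.le))
  rw [← collisionPairSum_const_mul hfin]
  refine collisionPairSum_mono hfin fun s hs p _ => ?_
  have hD := deficit_le hz p.1 p.2 (ℓ := κ * hsDiameter σ N) hs.2.1 hℓ.le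
  by_cases hsh : s - κ * hsDiameter σ N < pairFlightStart σ N Φ z p.1 p.2 s
  · rw [if_pos hsh, mul_one]
    exact mul_le_mul (hΨ _) hD (le_max_right _ _) hC
  · rw [if_neg hsh, mul_zero, max_eq_right (by linarith [not_lt.1 hsh]), mul_zero]

end Literature.MathematicalPhysics.KineticTheory

end
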